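import Literature.MathematicalPhysics.QuantumLattice.StabilityPieceFamiliesProofs
import Literature.MathematicalPhysics.QuantumLattice.StabilitySmoothingCoreProofs
import HarnessLib

/-!
# The generator of Hastings' flow as a quasi-local interaction family (MZ13 §5.2)

Top-down layer (seat B) of the formalisation of the Michalakis–Zwolak stability theorem
(hubbard.S19, `Literature.MathematicalPhysics.QuantumLattice.michalakis_zwolak`). Along the path
`H_t = Σ Φ + t ε Σ V` the generator of the spectral flow is
`D(t) = ∫ W(τ) τ_τ^{H_t}(ε Σ_{Z'} V Z') dτ = ε Σ_{Z'} 𝓕_W^t(V Z')`. Decomposing each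
`𝓕_W^t(V Z')` into telescoping twirl pieces on the balls `b_{c(Z')}(r + k)` (`k ≤ L`;
`exists_ball_pieces_family_of_pow_tails`, with the uniform tails of `exists_smoothing_tail_bound`)
and grouping the pieces by support gives local interactions `Ψ_t`, continuous in `t`, with
`H(Ψ_t) = D(t)`, size-weighted local norm `≤ |ε| J₀` and, at every scale `θ`, long-range part
(terms of diameter `> 2θ`) of local norm `≤ |ε| K_p/(θ+1)^p` — for `|t| ≤ 1`, with `J₀ ≥ 1` and
`K_p ≥ 0` depending only on `W, d, κ, q, r₀, r` (`exists_generator_interaction`). This is the input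
of `norm_comm_flow_le_pow` (MZ13 Lemma 2: "`D_Y(s) = Σ_{Z ⊂ Y} Φ'_Λ(Z, s)` … each term supported on
`Z`", arXiv:1109.1588 p. 12; BMNS arXiv:1102.0842 §4). No definitions, no named facts (theorems
only).
-/

noncomputable section

open Matrix Complex MeasureTheory Finset
open scoped Matrix.Norms.L2Operator

namespace Literature.MathematicalPhysics.QuantumLattice

open Literature.Probability.LatticeModels

/-! ### Two real-sum estimates -/

/-- The radius bookkeeping `2(r+k)+1 ≤ 2(r+1)(k+1)`. [folklore] -/
theorem two_mul_add_succ_le (r k : ℕ) : (2 * ((r : ℝ) + k) + 1) ≤ 2 * ((r : ℝ) + 1) * ((k : ℝ) + 1) := by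
  have hr : (0 : ℝ) ≤ r := Nat.cast_nonneg r
  have hk : (0 : ℝ) ≤ k := Nat.cast_nonneg k
  nlinarith

/-- **The size-weighted local norm estimate**:
`Σ_{k<M} (2(r+k)+1)^d ((2(r+k)+1)^d c B/(k+1)^{2d+2}) ≤ 2 (2(r+1))^{2d} c B` (`c, B ≥ 0`).
[folklore] -/
theorem sum_weighted_envelope_le (d r M : ℕ) {c B : ℝ} (hc : 0 ≤ c) (hB : 0 ≤ B) :
    ∑ k ∈ range M, (2 * ((r : ℝ) + k) + 1) ^ d *
        ((2 * ((r : ℝ) + k) + 1) ^ d * c * (B / ((k : ℝ) + 1) ^ (2 * d + 2))) ≤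
      2 * (2 * ((r : ℝ) + 1)) ^ (2 * d) * c * B := by
  have hterm : ∀ k : ℕ, (2 * ((r : ℝ) + k) + 1) ^ d *
      ((2 * ((r : ℝ) + k) + 1) ^ d * c * (B / ((k : ℝ) + 1) ^ (2 * d + 2))) ≤
      (2 * ((r : ℝ) + 1)) ^ (2 * d) * c * B * (1 / ((k : ℝ) + 1) ^ 2) := by
    intro k
    have hk1 : (0 : ℝ) < (k : ℝ) + 1 := by positivity
    have h1 : (2 * ((r : ℝ) + k) + 1) ^ (2 * d) ≤ (2 * ((r : ℝ) + 1)) ^ (2 * d) * ((k : ℝ) + 1) ^ (2 * d) := by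
      rw [← mul_pow]; exact pow_le_pow_left₀ (by positivity) (two_mul_add_succ_le r k) _
    have e : (2 * ((r : ℝ) + k) + 1) ^ d * ((2 * ((r : ℝ) + k) + 1) ^ d * c *
        (B / ((k : ℝ) + 1) ^ (2 * d + 2))) =
        (2 * ((r : ℝ) + k) + 1) ^ (2 * d) * (c * B) / (((k : ℝ) + 1) ^ (2 * d) * ((k : ℝ) + 1) ^ 2) := by
      have h2d : 2 * d = d + d := two_mul d
      rw [h2d, pow_add, pow_add]; ring
    rw [e, div_le_iff₀ (by positivity)]
    calc (2 * ((r : ℝ) + k) + 1) ^ (2 * d) * (c * B)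
        ≤ (2 * ((r : ℝ) + 1)) ^ (2 * d) * ((k : ℝ) + 1) ^ (2 * d) * (c * B) :=
          mul_le_mul_of_nonneg_right h1 (by positivity)
      _ = (2 * ((r : ℝ) + 1)) ^ (2 * d) * c * B * (1 / ((k : ℝ) + 1) ^ 2) *
          (((k : ℝ) + 1) ^ (2 * d) * ((k : ℝ) + 1) ^ 2) := by field_simp
  calc ∑ k ∈ range M, (2 * ((r : ℝ) + k) + 1) ^ d *
        ((2 * ((r : ℝ) + k) + 1) ^ d * c * (B / ((k : ℝ) + 1) ^ (2 * d + 2)))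
      ≤ ∑ k ∈ range M, (2 * ((r : ℝ) + 1)) ^ (2 * d) * c * B * (1 / ((k : ℝ) + 1) ^ 2) :=
        sum_le_sum fun k _ => hterm k
    _ = (2 * ((r : ℝ) + 1)) ^ (2 * d) * c * B * ∑ k ∈ range M, 1 / ((k : ℝ) + 1) ^ 2 := by
        rw [mul_sum]
    _ ≤ (2 * ((r : ℝ) + 1)) ^ (2 * d) * c * B * 2 :=
        mul_le_mul_of_nonneg_left (sum_range_one_div_sq_le_two M) (by positivity)
    _ = _ := by ring

/-- **The long-range local norm estimate at scale `θ`**: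
`Σ_{k<M, θ<r+k} (2(r+k)+1)^d (c B/(k+1)^{p+d+2}) ≤ 2 (2(r+1))^d c B (r+1)^p/(θ+1)^p` (`c, B ≥ 0`).
[folklore] -/
theorem sum_longrange_envelope_le (d r M θ p : ℕ) {c B : ℝ} (hc : 0 ≤ c) (hB : 0 ≤ B) :
    ∑ k ∈ range M, (if θ < r + k then
        (2 * ((r : ℝ) + k) + 1) ^ d * (c * (B / ((k : ℝ) + 1) ^ (p + d + 2))) else 0) ≤
      2 * (2 * ((r : ℝ) + 1)) ^ d * c * B * ((r : ℝ) + 1) ^ p / ((θ : ℝ) + 1) ^ p := by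
  have hθ1 : (0 : ℝ) < (θ : ℝ) + 1 := by positivity
  have hterm : ∀ k : ℕ, (if θ < r + k then
      (2 * ((r : ℝ) + k) + 1) ^ d * (c * (B / ((k : ℝ) + 1) ^ (p + d + 2))) else 0) ≤
      (2 * ((r : ℝ) + 1)) ^ d * c * B * ((r : ℝ) + 1) ^ p / ((θ : ℝ) + 1) ^ p *
        (1 / ((k : ℝ) + 1) ^ 2) := by
    intro k
    have hk1 : (0 : ℝ) < (k : ℝ) + 1 := by positivity
    split_ifs with h
    · have h1 : (2 * ((r : ℝ) + k) + 1) ^ d ≤ (2 * ((r : ℝ) + 1)) ^ d * ((k : ℝ) + 1) ^ d := by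
        rw [← mul_pow]; exact pow_le_pow_left₀ (by positivity) (two_mul_add_succ_le r k) _
      -- `(θ+1)^p ≤ ((r+1)(k+1))^p`
      have h2 : ((θ : ℝ) + 1) ^ p ≤ ((r : ℝ) + 1) ^ p * ((k : ℝ) + 1) ^ p := by
        rw [← mul_pow]
        refine pow_le_pow_left₀ hθ1.le ?_ p
        have : (θ : ℝ) + 1 ≤ (r : ℝ) + k + 1 := by exact_mod_cast (show θ + 1 ≤ r + k + 1 by omega)
        have hr : (0 : ℝ) ≤ r := Nat.cast_nonneg r
        have hk : (0 : ℝ) ≤ k := Nat.cast_nonneg k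
        nlinarith
      have e : (2 * ((r : ℝ) + k) + 1) ^ d * (c * (B / ((k : ℝ) + 1) ^ (p + d + 2))) =
          (2 * ((r : ℝ) + k) + 1) ^ d * (c * B) /
            (((k : ℝ) + 1) ^ p * ((k : ℝ) + 1) ^ d * ((k : ℝ) + 1) ^ 2) := by
        rw [pow_add, pow_add]; ring
      rw [e, div_le_iff₀ (by positivity)]
      have e2 : (2 * ((r : ℝ) + 1)) ^ d * c * B * ((r : ℝ) + 1) ^ p / ((θ : ℝ) + 1) ^ p *
          (1 / ((k : ℝ) + 1) ^ 2) * (((k : ℝ) + 1) ^ p * ((k : ℝ) + 1) ^ d * ((k : ℝ) + 1) ^ 2) =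
          (2 * ((r : ℝ) + 1)) ^ d * ((k : ℝ) + 1) ^ d * (c * B) *
            ((((r : ℝ) + 1) ^ p * ((k : ℝ) + 1) ^ p) / ((θ : ℝ) + 1) ^ p) := by
        field_simp
      rw [e2]
      have h3 : 1 ≤ (((r : ℝ) + 1) ^ p * ((k : ℝ) + 1) ^ p) / ((θ : ℝ) + 1) ^ p := by
        rw [le_div_iff₀ (pow_pos hθ1 p), one_mul]; exact h2
      calc (2 * ((r : ℝ) + k) + 1) ^ d * (c * B)
          ≤ (2 * ((r : ℝ) + 1)) ^ d * ((k : ℝ) + 1) ^ d * (c * B) :=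
            mul_le_mul_of_nonneg_right h1 (by positivity)
        _ = (2 * ((r : ℝ) + 1)) ^ d * ((k : ℝ) + 1) ^ d * (c * B) * 1 := (mul_one _).symm
        _ ≤ _ := mul_le_mul_of_nonneg_left h3 (by positivity)
    · positivity
  calc ∑ k ∈ range M, (if θ < r + k then
        (2 * ((r : ℝ) + k) + 1) ^ d * (c * (B / ((k : ℝ) + 1) ^ (p + d + 2))) else 0)
      ≤ ∑ k ∈ range M, (2 * ((r : ℝ) + 1)) ^ d * c * B * ((r : ℝ) + 1) ^ p / ((θ : ℝ) + 1) ^ p *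
        (1 / ((k : ℝ) + 1) ^ 2) := sum_le_sum fun k _ => hterm k
    _ = (2 * ((r : ℝ) + 1)) ^ d * c * B * ((r : ℝ) + 1) ^ p / ((θ : ℝ) + 1) ^ p *
        ∑ k ∈ range M, 1 / ((k : ℝ) + 1) ^ 2 := by rw [mul_sum]
    _ ≤ (2 * ((r : ℝ) + 1)) ^ d * c * B * ((r : ℝ) + 1) ^ p / ((θ : ℝ) + 1) ^ p * 2 :=
        mul_le_mul_of_nonneg_left (sum_range_one_div_sq_le_two M) (by positivity)
    _ = _ := by ring

/-! ### The generator interaction -/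

section Generator

variable (d : ℕ) (κ : Type*) [Fintype κ] [DecidableEq κ] (q : ℕ)

set_option maxHeartbeats 1600000 in
/-- **The generator of Hastings' flow is a quasi-local interaction, uniformly in the volume and
the coupling (MZ13 §5.2).** See the module docstring.
[cite: MichalakisZwolakCMP2013, §5.2 Lemma 2 (arXiv:1109.1588 p. 12)] -/
theorem exists_generator_interaction {W : ℝ → ℂ} (hWi : Integrable W)
    (hWmomi : ∀ k : ℕ, Integrable fun t : ℝ => ‖t‖ ^ k * ‖W t‖)
    (hWr : ∀ t : ℝ, starRingEnd ℂ (W t) = W t) (r₀ r : ℕ) :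
    ∃ J₀ : ℝ, 1 ≤ J₀ ∧ ∃ K : ℕ → ℝ, (∀ p, 0 ≤ K p) ∧
      ∀ {L : ℕ} [NeZero L] {Φ V : Interaction (TorusSite d L × κ) q}, Φ.IsLocal →
      (∀ Z, r₀ < torusDiam Z → Φ Z = 0) → (∀ Z, ‖Φ Z‖ ≤ 1) → V.IsLocal →
      (∀ Z, r < torusDiam Z → V Z = 0) → (∀ Z, ‖V Z‖ ≤ 1) → ∀ {ε : ℝ}, |ε| ≤ 1 →
      ∃ Ψ : ℝ → Interaction (TorusSite d L × κ) q,
        (∀ t, (Ψ t).IsLocal) ∧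
        (∀ Z, Continuous fun t => Ψ t Z) ∧
        (∀ t : ℝ, localHamiltonian (Ψ t) univ =
          ∫ τ : ℝ, W τ • heisenbergEvolution (∑ Z, Φ Z + t • ((ε : ℂ) • ∑ Z, V Z)) τ
            ((ε : ℂ) • ∑ Z, V Z)) ∧
        (∀ t : ℝ, |t| ≤ 1 → ∀ y : TorusSite d L × κ,
          ∑ Z ∈ univ.filter (fun Z : Finset (TorusSite d L × κ) => y ∈ Z),
            (#Z : ℝ) * ‖Ψ t Z‖ ≤ |ε| * J₀) ∧
        (∀ (p θ : ℕ) (t : ℝ), |t| ≤ 1 → ∀ y : TorusSite d L × κ,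
          ∑ Z ∈ univ.filter (fun Z : Finset (TorusSite d L × κ) => y ∈ Z),
            ‖(if torusDiam Z ≤ 2 * θ then (0 : Op (TorusSite d L × κ) q) else Ψ t Z)‖ ≤
            |ε| * (K p / ((θ : ℝ) + 1) ^ p)) := by
  classical
  -- uniform constants
  choose C hC0 hC using fun p : ℕ => exists_smoothing_tail_bound d κ q hWi hWmomi r₀ r r p
  set Nw : ℝ := ∫ t : ℝ, ‖W t‖ with hNw
  have hNw0 : 0 ≤ Nw := integral_nonneg fun t => norm_nonneg _
  set C' : ℕ → ℝ := fun p => C p + Nw with hC'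
  have hC'0 : ∀ p, 0 ≤ C' p := fun p => add_nonneg (hC0 p) hNw0
  -- envelope of the pieces: `G p k = (C' 0 + 2 C' p 2^p)/(k+1)^p`
  set Bc : ℕ → ℝ := fun p => C' 0 + 2 * C' p * 2 ^ p with hBc
  have hBc0 : ∀ p, 0 ≤ Bc p := fun p => by have := hC'0 0; have := hC'0 p; positivity
  set Nr : ℝ := (2 : ℝ) ^ ((2 * r + 1) ^ d * Fintype.card κ) with hNr
  have hNr0 : 0 ≤ Nr := by positivity
  set cκ : ℝ := (Fintype.card κ : ℝ) with hcκ
  refine ⟨1 + 2 * (2 * ((r : ℝ) + 1)) ^ (2 * d) * (cκ * Nr) * Bc (2 * d + 2), ?_,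
    fun p => 2 * (2 * ((r : ℝ) + 1)) ^ d * Nr * Bc (p + d + 2) * ((r : ℝ) + 1) ^ p, fun p => ?_, ?_⟩
  · have := hBc0 (2 * d + 2)
    have : 0 ≤ 2 * (2 * ((r : ℝ) + 1)) ^ (2 * d) * (cκ * Nr) * Bc (2 * d + 2) := by positivity
    linarith
  · have := hBc0 (p + d + 2); positivity
  intro L _ Φ V hΦ hΦr hΦn hV hVr hVn ε hε
  -- the path
  set H₀ : Op (TorusSite d L × κ) q := ∑ Z, Φ Z with hH₀def
  set X' : Op (TorusSite d L × κ) q := (ε : ℂ) • ∑ Z, V Z with hX'def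
  have hH₀h : H₀.IsHermitian := by
    rw [hH₀def, ← localHamiltonian_univ_eq_sum]; exact localHamiltonian_isHermitian hΦ univ
  have hV₁h : (∑ Z, V Z).IsHermitian := by
    rw [← localHamiltonian_univ_eq_sum]; exact localHamiltonian_isHermitian hV univ
  have hX'h : X'.IsHermitian := isHermitian_ofReal_smul hV₁h ε
  have hHt : ∀ t : ℝ, (H₀ + t • X').IsHermitian := fun t => hH₀h.add (hX'h.smul (IsSelfAdjoint.all t))
  have hpath : ∀ t : ℝ, H₀ + t • X' = ∑ Z, Φ Z + ((t * ε : ℝ) : ℂ) • ∑ Z, V Z := by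
    intro t
    rw [hX'def, ← Complex.coe_smul, smul_smul, ← Complex.ofReal_mul]
  -- centres
  set x₀ : TorusSite d L := fun _ => 0 with hx₀
  set c : Finset (TorusSite d L × κ) → TorusSite d L :=
    fun Z => if h : Z.Nonempty then h.choose.1 else x₀ with hcdef
  have hcV : ∀ Z, V Z ≠ 0 → Z ⊆ cellBall (c Z) r := by
    intro Z hZ
    have hR : torusDiam Z ≤ r := not_lt.mp fun h => hZ (hVr Z h)
    by_cases h : Z.Nonempty
    · have hc : c Z = h.choose.1 := by simp only [hcdef, dif_pos h]
      rw [hc]; exact subset_cellBall_of_mem_of_torusDiam_le h.choose_spec hR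
    · rw [Finset.not_nonempty_iff_eq_empty.mp h]; exact Finset.empty_subset _
  have hVsupp : ∀ Z, IsSupportedOn (V Z) (cellBall (c Z) r) := by
    intro Z
    by_cases hZ : V Z = 0
    · rw [hZ]; exact IsSupportedOn.zero _
    · exact IsSupportedOn.mono_holds (hV.isSupportedOn Z) (hcV Z hZ)
  -- the smoothed terms `F Z t = 𝓕_W^t(V Z)`
  set F : Finset (TorusSite d L × κ) → ℝ → Op (TorusSite d L × κ) q :=
    fun Z t => ∫ τ : ℝ, W τ • heisenbergEvolution (H₀ + t • X') τ (V Z) with hFdef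
  have hFh : ∀ Z t, (F Z t).IsHermitian := fun Z t =>
    isHermitian_integral_smul_heisenbergEvolution (hHt t) (hV.isHermitian Z) hWi hWr
  have hFc : ∀ Z, Continuous (F Z) := fun Z =>
    continuous_integral_smul_heisenbergEvolution_affine hH₀h hX'h hWi (V Z)
  have hFn : ∀ Z t, ‖F Z t‖ ≤ 1 * C' 0 := by
    intro Z t
    rw [one_mul]
    calc ‖F Z t‖ ≤ Nw * ‖V Z‖ := norm_integral_smul_heisenbergEvolution_le (hHt t) W (V Z)
      _ ≤ Nw * 1 := mul_le_mul_of_nonneg_left (hVn Z) hNw0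
      _ ≤ C' 0 := by rw [mul_one]; exact le_add_of_nonneg_left (hC0 0)
  have hFtail : ∀ Z, ∀ t ∈ {t : ℝ | |t| ≤ 1}, ∀ k p : ℕ,
      ‖F Z t - twirl (cellBall (c Z) (r + k) : Finset (TorusSite d L × κ))ᶜ (F Z t)‖ ≤
        1 * (C' p / ((k : ℝ) + 1) ^ p) := by
    intro Z t ht k p
    have htε : |t * ε| ≤ 1 := by
      rw [abs_mul]; exact mul_le_one₀ ht (abs_nonneg ε) hε
    have h := hC p hΦ hΦr hΦn hV hVr hVn htε (c Z) (hVsupp Z) k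
    rw [← hpath t] at h
    rw [one_mul]
    refine h.trans ?_
    calc ‖V Z‖ * (C p / ((k : ℝ) + 1) ^ p) ≤ 1 * (C p / ((k : ℝ) + 1) ^ p) :=
          mul_le_mul_of_nonneg_right (hVn Z) (div_nonneg (hC0 p) (by positivity))
      _ ≤ C' p / ((k : ℝ) + 1) ^ p := by
          rw [one_mul]
          exact div_le_div_of_nonneg_right (le_add_of_nonneg_right hNw0) (by positivity)
  have hFzero : ∀ Z t, V Z = 0 → F Z t = 0 := by
    intro Z t hZ
    simp only [hFdef, hZ]
    have : ∀ τ : ℝ, heisenbergEvolution (H₀ + t • X') τ (0 : Op (TorusSite d L × κ) q) = 0 := by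
      intro τ; simp [heisenbergEvolution]
    simp [this]
  -- the pieces
  have hexP : ∀ Z, ∃ P : ℕ → ℝ → Op (TorusSite d L × κ) q,
      (∀ t, ∑ k ∈ range (L + 1), P k t = F Z t) ∧
      (∀ k t, (P k t).IsHermitian) ∧
      (∀ k t, IsSupportedOn (P k t) (cellBall (c Z) (r + k))) ∧
      (∀ k, Continuous (P k)) ∧
      (∀ t, F Z t = 0 → ∀ k, P k t = 0) ∧
      (∀ t ∈ {t : ℝ | |t| ≤ 1}, ∀ k p : ℕ, ‖P k t‖ ≤ 1 * (Bc p / ((k : ℝ) + 1) ^ p)) := fun Z =>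
    exists_ball_pieces_family_of_pow_tails (c Z) r (hFh Z) (hFc Z) zero_le_one hC'0
      (fun t _ => hFn Z t) (hFtail Z)
  choose P hPsum hPh hPs hPc hPzero hPn using hexP
  -- aggregation by centre: `Q (u, k) t = Σ_{c Z' = u} P Z' k t`
  set Q : TorusSite d L × Fin (L + 1) → ℝ → Op (TorusSite d L × κ) q :=
    fun i t => ∑ Z' ∈ univ.filter (fun Z' : Finset (TorusSite d L × κ) => c Z' = i.1), P Z' i.2 t
    with hQdef
  set S : TorusSite d L × Fin (L + 1) → Finset (TorusSite d L × κ) :=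
    fun i => cellBall i.1 (r + i.2) with hSdef
  have hQs : ∀ i t, IsSupportedOn (Q i t) (S i) := fun i t =>
    IsSupportedOn.sum _ fun Z' hZ' => by
      simp only [mem_filter, mem_univ, true_and] at hZ'
      rw [hSdef]; simp only; rw [← hZ']; exact hPs Z' i.2 t
  have hQh : ∀ i t, (Q i t).IsHermitian := fun i t => by
    simp only [hQdef]
    rw [IsHermitian, conjTranspose_sum]
    exact sum_congr rfl fun Z' _ => (hPh Z' i.2 t).eq
  have hQc : ∀ i, Continuous fun t => Q i t := fun i =>
    continuous_finsetSum _ fun Z' _ => hPc Z' i.2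
  -- norm of the aggregated pieces: at most `Nr` non-zero terms per centre
  have hQn : ∀ (u : TorusSite d L) (k : Fin (L + 1)) (t : ℝ), |t| ≤ 1 → ∀ p : ℕ,
      ‖Q (u, k) t‖ ≤ Nr * (Bc p / (((k : ℕ) : ℝ) + 1) ^ p) := by
    intro u k t ht p
    set T := (univ.filter (fun Z' : Finset (TorusSite d L × κ) => c Z' = u)).filter
      (fun Z' => V Z' ≠ 0) with hT
    have h1 : Q (u, k) t = ∑ Z' ∈ T, P Z' k t := by
      simp only [hQdef, hT]
      symm
      exact sum_filter_of_ne fun Z' _ hne hV0 => hne (hPzero Z' t (hFzero Z' t hV0) k)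
    have h2 : ∀ Z' ∈ T, Z' ⊆ cellBall u r := by
      intro Z' hZ'
      simp only [hT, mem_filter, mem_univ, true_and] at hZ'
      rw [← hZ'.1]; exact hcV Z' hZ'.2
    have h3 : (T.card : ℝ) ≤ Nr := by
      have := card_filter_subset_le_two_pow u r T h2
      rw [hNr]; exact_mod_cast this
    rw [h1]
    calc ‖∑ Z' ∈ T, P Z' k t‖ ≤ ∑ Z' ∈ T, ‖P Z' k t‖ := norm_sum_le _ _
      _ ≤ ∑ _Z' ∈ T, Bc p / (((k : ℕ) : ℝ) + 1) ^ p :=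
          sum_le_sum fun Z' _ => by have := hPn Z' t ht k p; rwa [one_mul] at this
      _ = T.card * (Bc p / (((k : ℕ) : ℝ) + 1) ^ p) := by rw [sum_const, nsmul_eq_mul]
      _ ≤ Nr * (Bc p / (((k : ℕ) : ℝ) + 1) ^ p) :=
          mul_le_mul_of_nonneg_right h3 (div_nonneg (hBc0 p) (by positivity))
  -- the interaction family
  set Ψ : ℝ → Interaction (TorusSite d L × κ) q :=
    fun t Z => (ε : ℂ) • ∑ i ∈ univ.filter (fun i => S i = Z), Q i t with hΨdef
  have hRloc : ∀ t, Interaction.IsLocal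
      (fun Z : Finset (TorusSite d L × κ) => ∑ i ∈ univ.filter (fun i => S i = Z), Q i t) :=
    fun t => isLocal_reindex S (fun i => hQs i t) (fun i => hQh i t)
  refine ⟨Ψ, fun t Z => ⟨?_, ?_⟩, fun Z => ?_, fun t => ?_, fun t ht y => ?_, fun p θ t ht y => ?_⟩
  · -- locality: supports
    exact ((hRloc t).isSupportedOn Z).smul _
  · -- locality: hermiticity
    exact isHermitian_ofReal_smul ((hRloc t).isHermitian Z) ε
  · -- continuity
    show Continuous fun t => (ε : ℂ) • ∑ i ∈ univ.filter (fun i => S i = Z), Q i t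
    exact (continuous_finsetSum _ fun i _ => hQc i).const_smul (ε : ℂ)
  · -- the total is the generator
    rw [localHamiltonian_univ_eq_sum]
    change ∑ Z, (ε : ℂ) • ∑ i ∈ univ.filter (fun i => S i = Z), Q i t = _
    rw [← smul_sum, sum_fiberwise univ S (fun i => Q i t)]
    have h1 : ∑ i, Q i t = ∑ Z', F Z' t := by
      rw [Fintype.sum_prod_type, sum_comm]
      simp only [hQdef]
      have h2 : ∀ k : Fin (L + 1), ∑ u : TorusSite d L,
          ∑ Z' ∈ univ.filter (fun Z' : Finset (TorusSite d L × κ) => c Z' = u), P Z' k t =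
          ∑ Z', P Z' k t := fun k =>
        sum_fiberwise_of_maps_to (g := c) (fun Z' _ => mem_univ _) _
      simp only [h2]
      rw [sum_comm]
      refine sum_congr rfl fun Z' _ => ?_
      rw [← hPsum Z' t, ← Fin.sum_univ_eq_sum_range]
    rw [h1]
    have h3 : ∑ Z', F Z' t = ∫ τ : ℝ, W τ • heisenbergEvolution (H₀ + t • X') τ (∑ Z', V Z') := by
      simp only [hFdef]
      rw [map_finset_sum_of_add (F := fun O => ∫ τ : ℝ, W τ • heisenbergEvolution (H₀ + t • X') τ O)
        (fun A B => integral_smul_heisenbergEvolution_add (hHt t) hWi A B)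
        (fun a A => integral_smul_heisenbergEvolution_smul _ W a A)]
    rw [h3, ← integral_smul_heisenbergEvolution_smul]
  · -- the size-weighted local norm
    have hε0 : 0 ≤ |ε| := abs_nonneg ε
    have e1 : ∀ Z : Finset (TorusSite d L × κ), (#Z : ℝ) * ‖Ψ t Z‖ =
        |ε| * ((#Z : ℝ) * ‖∑ i ∈ univ.filter (fun i => S i = Z), Q i t‖) := by
      intro Z
      simp only [hΨdef, norm_smul, Complex.norm_real, Real.norm_eq_abs]
      ring
    simp only [e1]
    rw [← mul_sum]
    refine mul_le_mul_of_nonneg_left ?_ hε0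
    refine (sum_card_mul_norm_reindex_le S (fun i => Q i t) y).trans ?_
    -- weighted pieces `Q' i = |S i| • Q i t`
    set Q' : TorusSite d L × Fin (L + 1) → Op (TorusSite d L × κ) q :=
      fun i => ((#(S i) : ℕ) : ℂ) • Q i t with hQ'
    have e2 : ∀ i, (#(S i) : ℝ) * ‖Q i t‖ = ‖Q' i‖ := fun i => by
      simp only [hQ', norm_smul, Complex.norm_natCast]
    simp only [e2]
    have hG : ∀ (u : TorusSite d L) (k : Fin (L + 1)), ‖Q' (u, k)‖ ≤
        (2 * ((r : ℝ) + ((k : ℕ) : ℝ)) + 1) ^ d * cκ * Nr * (Bc (2 * d + 2) /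
          (((k : ℕ) : ℝ) + 1) ^ (2 * d + 2)) := by
      intro u k
      rw [← e2]
      have hcard : (#(S (u, k)) : ℝ) ≤ (2 * ((r : ℝ) + ((k : ℕ) : ℝ)) + 1) ^ d * cκ := by
        have := card_cellBall_le (κ := κ) u (r + k)
        rw [hSdef, hcκ]; push_cast at this ⊢; exact_mod_cast this
      calc (#(S (u, k)) : ℝ) * ‖Q (u, k) t‖
          ≤ ((2 * ((r : ℝ) + ((k : ℕ) : ℝ)) + 1) ^ d * cκ) * (Nr * (Bc (2 * d + 2) /
            (((k : ℕ) : ℝ) + 1) ^ (2 * d + 2))) :=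
            mul_le_mul hcard (hQn u k t ht _) (by positivity) (by positivity)
        _ = _ := by ring
    have key := sum_norm_pieces_le r L Q' (G := fun k => (2 * ((r : ℝ) + k) + 1) ^ d * cκ * Nr *
      (Bc (2 * d + 2) / ((k : ℝ) + 1) ^ (2 * d + 2)))
      (fun k => by have := hBc0 (2 * d + 2); positivity) hG y (fun _ => True)
    have hfilter : (univ.filter fun i : TorusSite d L × Fin (L + 1) => y ∈ S i) =
        univ.filter fun i : TorusSite d L × Fin (L + 1) =>
          y ∈ (cellBall i.1 (r + i.2) : Finset (TorusSite d L × κ)) ∧ True := by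
      simp only [and_true, hSdef]
    rw [hfilter]
    refine key.trans ?_
    simp only [if_true]
    rw [Fin.sum_univ_eq_sum_range (fun k => (((2 * (r + k) + 1) ^ d : ℕ) : ℝ) *
      ((2 * ((r : ℝ) + k) + 1) ^ d * cκ * Nr * (Bc (2 * d + 2) / ((k : ℝ) + 1) ^ (2 * d + 2)))) (L + 1)]
    have h4 := sum_weighted_envelope_le d r (L + 1) (c := cκ * Nr) (B := Bc (2 * d + 2))
      (by positivity) (hBc0 _)
    refine le_trans (le_of_eq ?_) (h4.trans (by linarith))
    refine sum_congr rfl fun k _ => ?_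
    push_cast; ring
  · -- the long-range part at scale `θ`
    have hε0 : 0 ≤ |ε| := abs_nonneg ε
    have e1 : ∀ Z : Finset (TorusSite d L × κ),
        ‖(if torusDiam Z ≤ 2 * θ then (0 : Op (TorusSite d L × κ) q) else Ψ t Z)‖ =
        |ε| * ‖(if torusDiam Z ≤ 2 * θ then (0 : Op (TorusSite d L × κ) q) else
          ∑ i ∈ univ.filter (fun i => S i = Z), Q i t)‖ := by
      intro Z
      split_ifs
      · simp
      · simp only [hΨdef, norm_smul, Complex.norm_real, Real.norm_eq_abs]
    simp only [e1]
    rw [← mul_sum]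
    refine mul_le_mul_of_nonneg_left ?_ hε0
    refine (sum_norm_reindex_not_le S (fun i => Q i t) y (fun Z => torusDiam Z ≤ 2 * θ)).trans ?_
    -- long-range supports have radius index `k` with `θ < r + k`
    have hsub : (univ.filter fun i : TorusSite d L × Fin (L + 1) =>
        y ∈ S i ∧ ¬ torusDiam (S i) ≤ 2 * θ) ⊆
        univ.filter fun i : TorusSite d L × Fin (L + 1) =>
          y ∈ (cellBall i.1 (r + i.2) : Finset (TorusSite d L × κ)) ∧ θ < r + (i.2 : ℕ) := by
      intro i hi
      simp only [mem_filter, mem_univ, true_and, hSdef] at hi ⊢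
      refine ⟨hi.1, ?_⟩
      have := torusDiam_cellBall_le (κ := κ) i.1 (r + i.2)
      omega
    refine (sum_le_sum_of_subset_of_nonneg hsub fun _ _ _ => norm_nonneg _).trans ?_
    have hG : ∀ (u : TorusSite d L) (k : Fin (L + 1)), ‖Q (u, k) t‖ ≤
        Nr * (Bc (p + d + 2) / (((k : ℕ) : ℝ) + 1) ^ (p + d + 2)) := fun u k => hQn u k t ht _
    have key := sum_norm_pieces_le r L (fun i => Q i t)
      (G := fun k => Nr * (Bc (p + d + 2) / ((k : ℝ) + 1) ^ (p + d + 2)))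
      (fun k => by have := hBc0 (p + d + 2); positivity) hG y (fun k => θ < r + (k : ℕ))
    refine key.trans ?_
    rw [Fin.sum_univ_eq_sum_range (fun k => if θ < r + k then (((2 * (r + k) + 1) ^ d : ℕ) : ℝ) *
      (Nr * (Bc (p + d + 2) / ((k : ℝ) + 1) ^ (p + d + 2))) else 0) (L + 1)]
    have h4 := sum_longrange_envelope_le d r (L + 1) θ p hNr0 (hBc0 (p + d + 2))
    refine le_trans (le_of_eq ?_) (h4.trans (le_of_eq (by ring)))
    refine sum_congr rfl fun k _ => ?_
    split_ifs
    · push_cast; ring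
    · rfl

end Generator

end Literature.MathematicalPhysics.QuantumLattice
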